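/-
Copyright: ns-blowup cell (selfsim seat). Exponent ledger, companion to
`PalasekTowerExponentLedger` (instab seat, RATE-AUDIT §6).
-/
import Mathlib.Analysis.SpecialFunctions.Pow.Real

/-!
# Heredity ledger for the marginal / accumulator tower (door O-acc, `N_{k+1}² = ¼A_k`)

Cell `ns-blowup`, selfsim memo `HEREDITY.md` §1–§2 (P-SELFSIM-5, part A).  WHAT THIS IS NOT:
not a statement about Navier–Stokes; kernel-checked exponent bookkeeping for a MODEL door.

Units: `M := N_k` is the frequency of the level whose CHILD (level `k+1`) is being fed; at the
marginal lacunarity `b = β/2` one has `A_k = M^β`, `A_{k-1} = M²`, level-`k` velocity `M^{β-1}`,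
level-`k` cell `M^{-1}`, single-structure flux `Φ_k ≍ M^{β-2}`, child window `c/A_{k-1} = cM^{-2}`,
child target `A_{k+1} ≍ M^{β²/2}`.

* O-acc's schedule (RATE-AUDIT §6.1–6.2) ASSUMES the child imports co-signed level-`k` flux at the
  rate `χ Φ_k A_k`; then the child's vorticity exponent at the end of the window is `3β - 4` and the
  slack against the target is `3β - 4 - β²/2` (`accumulator_slack_pos`, instab).
* LEMMA C (memo §1, exact kinematics): a COLUMNAR level `k` (velocity independent of the coordinate
  along its parent's stretching axis: Kerr–Dold arrays, Burgers lattices, rib/roller braids) has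
  vorticity parallel to that axis, hence ZERO component along the stretching direction of every
  one of its own hyperbolic lines, which moreover carry PLANE strain `(+s, -s, 0)` only.  The child
  can then be fed only by vorticity of levels `≤ k-1` (`≤ 2A_{k-1} = 2M²`), swept in at the level-`k`
  speed `M^{β-1}` across a level-`k` cell `M^{-1}`: import rate exponent `β`, imported flux over the
  window exponent `β - 2` (i.e. `O(1)` level-`k` fluxes), child vorticity exponent `2β - 2`.
* The theorems below record: the columnar child's slack `2β - 2 - β²/2 = -(β-2)²/2` is negative for
  every `β ≠ 2` and equals minus the marginal frozen-in deficit `(β/2-1)(β-2)` of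
  `deficitExp_at_marginal`; the loss relative to O-acc's schedule is exactly the window exponent
  `β - 2`, which exceeds the schedule's efficiency tolerance `3β - 4 - β²/2` by `(β-2)²/2`.
  Consequence (memo §2): every level of an accumulator tower must be genuinely three-dimensional
  (an `O(1)` co-signed component of its OWN vorticity along the stretching direction of its own
  stagnation LINES, with two-dimensional convergence there) — columnar levels are terminal.
-/

namespace Summit.NavierStokesRegularity.FluidComputer.AccumulatorHeredity

/-- Bookkeeping of LEMMA C's import bound: grandparent vorticity (`M²`) × level-`k` speed
(`M^{β-1}`) × level-`k` cell (`M^{-1}`) gives the import-rate exponent `β`; over the child window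
(`M^{-2}`) the imported-flux exponent is `β - 2`, the exponent of ONE level-`k` flux. -/
theorem columnar_import_exp (β : ℝ) : 2 + (β - 1) + (-1) + (-2) = β - 2 := by ring

/-- The columnar child's vorticity exponent: imported flux (`β - 2`) times the level-`k` strain
(`β`) at the Burgers radius gives `2β - 2` — the vorticity of one collapsed host flux
(RATE-AUDIT §6.5(i)). -/
theorem columnar_child_vorticity_exp (β : ℝ) : (β - 2) + β = 2 * β - 2 := by ring

/-- HEREDITY SLACK (memo §1, LEMMA C corollary): a child fed only by grandparent vorticity misses
the marginal target `A_{k+1} ≍ M^{β²/2}` by the exponent `-(β-2)²/2`. -/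
theorem heredity_slack_eq (β : ℝ) : (2 * β - 2) - β ^ 2 / 2 = -((β - 2) ^ 2 / 2) := by ring

/-- … which is minus the marginal frozen-in deficit `d₁ = (b-1)(β-2)` at `b = β/2`
(`PalasekTowerExponentLedger.deficitExp_at_marginal`): grandparent feeding buys exactly nothing
against the Kelvin deficit. -/
theorem heredity_slack_eq_neg_deficit (β : ℝ) :
    (2 * β - 2) - β ^ 2 / 2 = -((β / 2 - 1) * (β - 2)) := by ring

/-- The columnar child's slack is strictly negative for every `β ≠ 2` (zero exactly on the
Kelvin-critical line `β = 2`). -/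
theorem heredity_slack_neg {β : ℝ} (hβ : β ≠ 2) : (2 * β - 2) - β ^ 2 / 2 < 0 := by
  have h : 0 < (β - 2) ^ 2 := by
    have h' : β - 2 ≠ 0 := sub_ne_zero.mpr hβ
    positivity
  nlinarith [h]

/-- On the Kelvin-critical line the slack vanishes. -/
theorem heredity_slack_critical : (2 * (2 : ℝ) - 2) - (2 : ℝ) ^ 2 / 2 = 0 := by norm_num

/-- LOSS = WINDOW: relative to O-acc's co-signed schedule (child exponent `3β - 4`) the columnar
child loses exactly the window exponent `β - 2` (`= A_k/A_{k-1}` in `M`-units,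
`PalasekTowerExponentLedger.windowExp_at_marginal`). -/
theorem heredity_loss_eq_window (β : ℝ) :
    (3 * β - 4 - β ^ 2 / 2) - ((2 * β - 2) - β ^ 2 / 2) = β - 2 := by ring

/-- Efficiency-exponent form of the accumulator window (RATE-AUDIT §6.2: "χ_k may decay like
`N^{-e}`"): a child whose co-signed import runs at `M^{-e}` times O-acc's schedule still closes iff
`e` is below the slack. -/
theorem fed_slack_pos_iff (β e : ℝ) :
    0 < (3 * β - 4 - β ^ 2 / 2) - e ↔ e < 3 * β - 4 - β ^ 2 / 2 := by
  constructor <;> intro h <;> linarith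

/-- The tolerance is strictly smaller than the columnar loss `β - 2` for every `β ≠ 2`: the gap is
`(β-2)²/2`.  Hence LEMMA C's columnar levels are TERMINAL for the accumulator tower at every
admissible `β`. -/
theorem tolerance_lt_columnar_loss {β : ℝ} (hβ : β ≠ 2) : 3 * β - 4 - β ^ 2 / 2 < β - 2 := by
  have h := heredity_slack_neg hβ
  linarith

/-- The gap between the columnar loss and the tolerance, in closed form. -/
theorem columnar_loss_sub_tolerance (β : ℝ) :
    (β - 2) - (3 * β - 4 - β ^ 2 / 2) = (β - 2) ^ 2 / 2 := by ring

/-- Instance at Palasek's corner `β = 5/2`: tolerance `3/8` (instab `accumulator_slack_le`) versus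
columnar loss `1/2`; gap `1/8`. -/
theorem corner_instance :
    (3 * (5 / 2 : ℝ) - 4 - (5 / 2 : ℝ) ^ 2 / 2 = 3 / 8) ∧ ((5 / 2 : ℝ) - 2 = 1 / 2) ∧
      ((5 / 2 : ℝ) - 2 - (3 * (5 / 2 : ℝ) - 4 - (5 / 2 : ℝ) ^ 2 / 2) = 1 / 8) := by
  norm_num

/-- PARTIAL 3-D CREDIT (memo §2): if a level delivers a co-signed fraction `M^{-e}` of its own flux
to its children (`e = 0`: O-acc's assumption; `e ≥ β - 2`: no better than columnar), the child
closes iff `e < 3β - 4 - β²/2`; in particular a CONSTANT efficiency (`e = 0`) closes on the whole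
window `2 < β < 4` (`PalasekTowerExponentLedger.accumulator_window_iff`). -/
theorem constant_efficiency_closes {β : ℝ} (h2 : 2 < β) (h4 : β < 4) :
    0 < (3 * β - 4 - β ^ 2 / 2) - 0 := by
  nlinarith [mul_pos (sub_pos.mpr h2) (sub_pos.mpr h4)]

/-! ### Append (memo §1 C3–C4(a)): the honest columnar child is a LAYER (1-D convergence at a type-β line) -/

/-- Layer form of LEMMA C (memo §1 C4(a)): aligned flux PER UNIT LENGTH imported over the window
has exponent `2 + (β-1) - 2 = β - 1` (grandparent vorticity × level-`k` speed × window); a Burgers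
LAYER of thickness `δ_{k+1} ≍ M^{-β/2}` then carries vorticity exponent `(β-1) + β/2 = 3β/2 - 1`. -/
theorem columnar_layer_child_exp (β : ℝ) : (2 + (β - 1) - 2) + β / 2 = 3 * β / 2 - 1 := by ring

/-- LAYER SLACK: the columnar (type-β, 1-D capture) child misses the marginal target `M^{β²/2}` by
the exponent `-(β-1)(β-2)/2`. -/
theorem layer_slack_eq (β : ℝ) : (3 * β / 2 - 1) - β ^ 2 / 2 = -((β - 1) * (β - 2) / 2) := by ring

/-- … which is strictly negative for every `β > 2` (indeed for `β ∉ [1,2]`). -/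
theorem layer_slack_neg {β : ℝ} (hβ : 2 < β) : (3 * β / 2 - 1) - β ^ 2 / 2 < 0 := by
  nlinarith [mul_pos (sub_pos.mpr (lt_trans one_lt_two hβ)) (sub_pos.mpr hβ)]

/-- The layer bound is STRICTLY WORSE (smaller child exponent) than the generous 2-D-capture bound
`2β - 2` exactly when `β > 2`: one-dimensional convergence concentrates less. The gap is `β/2 - 1`. -/
theorem layer_exp_lt_tube_exp {β : ℝ} (hβ : 2 < β) : 3 * β / 2 - 1 < 2 * β - 2 := by linarith

/-- Gap between the two columnar bounds in closed form. -/
theorem tube_exp_sub_layer_exp (β : ℝ) : (2 * β - 2) - (3 * β / 2 - 1) = β / 2 - 1 := by ring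

/-- The layer deficit `(β-1)(β-2)/2` exceeds the marginal Kelvin deficit `d₁ = (β-2)²/2` by `(β-2)/2`:
a columnar parent is further from the schedule than a winding-1 Kelvin episode. -/
theorem layer_deficit_sub_kelvin_deficit (β : ℝ) :
    (β - 1) * (β - 2) / 2 - (β - 2) ^ 2 / 2 = (β - 2) / 2 := by ring

/-- Secondary roll-up of the layer into tubes (KH spacing `≍` thickness) multiplies the vorticity by
an `O(1)` factor only: in exponent terms it adds `0`, so the layer slack is final for columnar
parents (memo §1 C3). Stated as the trivial bookkeeping identity it is. -/
theorem rollup_adds_no_exponent (β : ℝ) : (3 * β / 2 - 1) + 0 - β ^ 2 / 2 = -((β - 1) * (β - 2) / 2) := by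
  ring

/-! ### Append (memo §1 C1, general form): critical lines of a columnar level

At a critical line of `u = Sx + v` (`S = diag(s_x, s_y, σ)`, `v = (v_x, v_y)(x,y)` planar), `∇u` has the
eigenvalue `σ > 0` along the column axis and two in-plane eigenvalues with `μ₊ + μ₋ = -σ` (real case; a
complex pair has both real parts `= -σ/2`).  Hence EITHER the point is an in-plane saddle (`μ₊ > 0 > μ₋`:
type β, one-dimensional convergence) OR both in-plane eigenvalues are non-positive and then each lies in
`[-σ, 0]`: two-dimensional convergence off the cores is possible only at the GRANDPARENT rate `≤ σ =
O(A_{k-1})` (a sibling site of level `k`), never at the child rate `O(A_k)`.  -/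

/-- In-plane saddle ⇒ type β: with `σ > 0`, `μ₊ + μ₋ = -σ`, `μ₊ μ₋ < 0`, `μ₋ ≤ μ₊`, exactly the two
eigenvalues `σ, μ₊` are positive and `μ₋` is negative (memo §1 C1). -/
theorem type_beta_of_planar_saddle {σ μp μm : ℝ} (hσ : 0 < σ) (htr : μp + μm = -σ)
    (hhyp : μp * μm < 0) (hord : μm ≤ μp) : 0 < σ ∧ 0 < μp ∧ μm < 0 := by
  have h1 : 0 < μp := by
    rcases lt_or_ge 0 μp with h | h
    · exact h
    · exfalso
      have : 0 ≤ μp * μm := mul_nonneg_of_nonpos_of_nonpos h (le_trans hord h)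
      linarith
  have h2 : μm < 0 := by
    rcases lt_or_ge μm 0 with h | h
    · exact h
    · exfalso
      have : 0 ≤ μp * μm := mul_nonneg h1.le h
      linarith
  exact ⟨hσ, h1, h2⟩

/-- Two-dimensional in-plane convergence is capped by the grandparent rate: if both in-plane
eigenvalues are non-positive and sum to `-σ`, each is at least `-σ` (memo §1 C1, general form:
off-core α-type lines of a columnar level converge at rate `≤ σ = O(A_{k-1})`, i.e. they are SIBLING
sites of level `k`, not child sites). -/
theorem planar_convergence_rate_le {σ μp μm : ℝ} (htr : μp + μm = -σ) (hp : μp ≤ 0) (hm : μm ≤ 0) :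
    -σ ≤ μp ∧ -σ ≤ μm := by
  constructor <;> linarith

/-- The same cap for a complex-conjugate in-plane pair `ρ ± iω`: `2ρ = -σ` gives `ρ = -σ/2`. -/
theorem planar_focus_rate {σ ρ : ℝ} (htr : ρ + ρ = -σ) : ρ = -σ / 2 := by linarith

/-- DICHOTOMY at a columnar critical line (real in-plane eigenvalues, `μ₋ ≤ μ₊`, `μ₊ + μ₋ = -σ`):
either a saddle (`0 < μ₊`, type β) or doubly converging at rate at most `σ` (`-σ ≤ μ₋ ≤ μ₊ ≤ 0`). -/
theorem columnar_critical_dichotomy {σ μp μm : ℝ} (htr : μp + μm = -σ) (hord : μm ≤ μp) :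
    0 < μp ∨ (-σ ≤ μm ∧ μm ≤ μp ∧ μp ≤ 0) := by
  rcases lt_or_ge 0 μp with h | h
  · exact Or.inl h
  · right
    refine ⟨by linarith, hord, h⟩

end Summit.NavierStokesRegularity.FluidComputer.AccumulatorHeredity
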